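import Mathlib
import Summits.NavierStokesRegularity.NavierStokesRegularity.Theorems.TaoLadderRungTwoBreakOneShiftWindowSensGrid
import HarnessLib

/-!
# One-shift window certificate, kernel side — part LXX: THE SHELL-WISE LIPSCHITZ CLAUSE `hDedge` FROM THE
# TWO-RUN SENSITIVITY CHAIN — every pair of admissible points gives twin realisations at distance `max B E` and
# starts within `a · dist`, so part LXIX bounds `|x_u(σ) − x_v(σ)|` on every window shell along the whole flight by
# `(pY + ZY)·dist + (pT + ZT)·(B + E)`; a finite comparison of the emitted vectors with `vmax / χ_b / χ_e` then gives
# the clause `hDedge` of `T4W76R.ClausesFor` & co. (cell harvest/h2-tao-ladder, seat p2; rung1/RUNG1-P2G16-REPORT.md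
# §83 (K2); support for K1(1) = `NoSurvivingDSSOne`, stmt-NavierStokesRegularity-20205)

MODEL lattice only (the finite WINDOW system of a Tao-type averaged cascade); nothing here is a statement about the
Navier–Stokes equations; no item is closed; nothing numerical is asserted.

* `OneShiftFrame.abs_decodeTail_sub_le_all` — a tail difference bounded on the flight is bounded at all times
  (decoded tails are clamped in time);
* `OneShiftFrame.twin_of_edges` — two admissible points whose wake / top tails differ by `≤ B` / `≤ E` on the flight
  have twin realisations `wterms (preclampTail ·) t` at distance `max B E` at every time;
* `OneShiftFrame.abs_run_sub_le_of_gridCE` — the two-run bound of part LXIX for the window runs of two `AdmLip` points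
  (the instance facts of the row, the replay Booleans of the wave, the sensitivity / link Booleans, `a ≤ pY_0`);
* **`OneShiftFrame.hDedge_of_gridCE`** — for the CONSTRUCTED window certificate `windowCertOfMatrix`: the above plus the
  comparison `(pY_s + ZY_s) ≤ vmax`, `(pT_s + ZT_s) ≤ χ_b`, `(pT_s + ZT_s) ≤ χ_e` on every step ⇒ the clause `hDedge`.
-/

noncomputable section

-- the sub-problem namespace repeats the summit name by design (D-0017)
set_option linter.dupNamespace false

namespace Summit.NavierStokesRegularity.NavierStokesRegularity.Theorems

namespace DSSOneShift

open Set Finset Metric Filter Topology TopologicalSpace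
open Literature.Analysis.ODE Literature.Analysis.FluidPDE Literature.Analysis.FluidPDE.TaoCascade
open Summit.NavierStokesRegularity.NavierStokesRegularity.Theorems.TaylorModelCert
open Summit.NavierStokesRegularity.NavierStokesRegularity.Theorems.TaylorModelReadout
open Summit.NavierStokesRegularity.NavierStokesRegularity.Theorems.CertificateGlueOn

variable {m : ℕ}

namespace OneShiftFrame

variable (F : OneShiftFrame m)

/-! ### Tail differences at all times -/

/-- A tail difference bounded on the flight `[0, τ̂ + r_τ]` is bounded at every real time (the decoded tails are
clamped in time). [folklore] -/
theorem abs_decodeTail_sub_le_all {u v : F.Space} {k : ℤ} {δ : ℝ}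
    (h : ∀ i, ∀ t ∈ Icc 0 F.τhi, |F.decodeTail u i k t - F.decodeTail v i k t| ≤ δ) (i : Fin m) (t : ℝ) :
    |F.decodeTail u i k t - F.decodeTail v i k t| ≤ δ := by
  have hp := (projIcc 0 F.τhi F.τhi_pos.le t).2
  have h1 := h i _ hp
  simpa [OneShiftFrame.decodeTail, Set.projIcc_val] using h1

/-- `-1` and `W` are not window shells. [folklore] -/
theorem not_inWindow_edges : ¬ F.InWindow (-1) ∧ ¬ F.InWindow (F.W : ℤ) :=
  ⟨fun h => by have := h.1; omega, fun h => lt_irrefl _ h.2⟩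

/-- **Two admissible points whose wake / top tails differ by at most `B` / `E` on the flight have TWIN realisations**
`wterms (preclampTail u) t`, `wterms (preclampTail v) t` at distance `max B E`, at every time `t`.
[cite: Tao2016AveragedNS, §4 Lemma 4.1 (4.8); cell vocabulary, harvest/h2-tao-ladder rung1/RUNG1-P2G16-REPORT.md §83] -/
theorem twin_of_edges (ε₀ : ℝ) (α : Fin m → Fin m → Fin m → ℤ × ℤ × ℤ → ℝ) {u v : F.Space} (hu : F.Adm u)
    (hv : F.Adm v) {B E : ℝ}
    (hB : ∀ i, ∀ t ∈ Icc 0 F.τhi, |F.decodeTail u i (-1) t - F.decodeTail v i (-1) t| ≤ B)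
    (hE : ∀ i, ∀ t ∈ Icc 0 F.τhi, |F.decodeTail u i F.W t - F.decodeTail v i F.W t| ≤ E) (t : ℝ) (q : F.TIdx) :
    Factor.Twin (max B E) (F.wterms ε₀ α (F.preclampTail u) t q).fa (F.wterms ε₀ α (F.preclampTail v) t q).fa ∧
      Factor.Twin (max B E) (F.wterms ε₀ α (F.preclampTail u) t q).fb (F.wterms ε₀ α (F.preclampTail v) t q).fb := by
  refine F.twin_wterms ε₀ α (fun i => ?_) (fun i => ?_) q
  · rw [F.preclampTail_eq_decodeTail hu i F.not_inWindow_edges.1, F.preclampTail_eq_decodeTail hv i F.not_inWindow_edges.1]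
    exact (F.abs_decodeTail_sub_le_all hB i t).trans (le_max_left _ _)
  · rw [F.preclampTail_eq_decodeTail hu i F.not_inWindow_edges.2, F.preclampTail_eq_decodeTail hv i F.not_inWindow_edges.2]
    exact (F.abs_decodeTail_sub_le_all hE i t).trans (le_max_right _ _)

/-! ### The clause `hDedge` from the grid -/

section Glue

variable {ε₀ : ℝ} {α : Fin m → Fin m → Fin m → ℤ × ℤ × ℤ → ℝ} {R : ℤ → ℝ}
variable {g : GridCD} {kd : KrawD} {e : F.SIdx ≃ Fin g.n}

/-- **THE TWO-RUN BOUND FOR A PAIR OF ADMISSIBLE POINTS.** With the instance facts of the row (`FrameMatch`, the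
term data presenting every realisation `wterms (preclampTail u) t`, the box-centre start `hP0`), the replay Booleans
of the wave, the sensitivity / link Booleans of part LXIX and `a ≤ pY_0`: for every two `AdmLip` points `u, v` whose
wake / top tails differ by at most `B` / `E` on the flight and whose window coordinates satisfy `a·|ξ_u − ξ_v| ≤ pY_0 · d`
(`d ≥ 0`), the window runs from their pre-clamped data satisfy, on every step `s` and every `τ ∈ [t_s, τ̂ + r_τ]` with
`τ ≤ t_s + h_s`, in every flat coordinate `c`: `|x_u(τ)_c − x_v(τ)_c| ≤ (pY_s + ZY_s)_c · d + (pT_s + ZT_s)_c · max B E`,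
and `0 ≤ (pT_s + ZT_s)_c`.
[cite: Tao2016AveragedNS, §4 Lemma 4.1 (4.8), §5.3; KapelaZgliczynski2009, §4 Lemma 8 / Thm. 9; cell vocabulary, harvest/h2-tao-ladder rung1/RUNG1-P2G16-REPORT.md §83 (K2)] -/
theorem abs_run_sub_le_of_gridCE (hε : 0 ≤ ε₀) (hα : IsCancellingCoeff α)
    (hEb : ∀ i, |F.tubeC i (-1)| + F.tubeR (-1) ≤ F.Eb) (hEt : ∀ i, |F.tubeC i F.W| + F.tubeR F.W ≤ F.Et)
    (M : F.FrameMatch g.toGridD kd e R)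
    (Tc : ℕ → F.TIdx → BTerm F.SIdx) (rows : F.SIdx → List F.TIdx)
    (hRDc : ∀ s ≤ g.S, IsRTEncl (g.es e M.hn s) (Tc s) (Tc s) rows (g.step s).RD)
    (hRD : ∀ u : F.Space, ∀ s ≤ g.S, ∀ r ∈ Ico 0 (g.h s).toReal,
      IsRTEncl (g.es e M.hn s) (Tc s) (F.wterms ε₀ α (F.preclampTail u) (g.t s + r)) rows (g.step s).RD)
    (hstep : ∀ s ≤ g.S, g.stepOK s = true) (hinit : g.initOK = true) (hprod : ∀ s < g.S, g.prodOKE s = true)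
    (hpwf : ∀ s ≤ g.S, g.pwfOK s = true) (hpsub : ∀ s ≤ g.S, g.psubOK s = true)
    (hplink : ∀ s < g.S, g.plinkOK s = true) (hwlink : ∀ s < g.S, g.wlinkOK s = true)
    (hP0 : (fun c : F.SIdx => F.yc c.1 ((c.2 : ℕ) : ℤ)) ∈ boxSet (boxOf e (g.P 0)))
    (sd : SensD) (hsens : ∀ s ≤ g.S, g.sensStepOK sd s = true) (hlink : ∀ s < g.S, g.sensLinkOK sd s = true)
    {u v : F.Space} (hu : F.AdmLip R u) (hv : F.AdmLip R v) {B E : ℝ}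
    (hB : ∀ i, ∀ t ∈ Icc 0 F.τhi, |F.decodeTail u i (-1) t - F.decodeTail v i (-1) t| ≤ B)
    (hE : ∀ i, ∀ t ∈ Icc 0 F.τhi, |F.decodeTail u i F.W t - F.decodeTail v i F.W t| ≤ E)
    {dd : ℝ} (hdd : 0 ≤ dd)
    (hd0 : ∀ c : F.SIdx, F.a c.1 ((c.2 : ℕ) : ℤ) * |u.1 c.1 c.2 - v.1 c.1 c.2| ≤ (sd.pYf 0 (e c)).toReal * dd) :
    ∀ s ≤ g.S, ∀ τ ∈ Icc (g.t s) F.τhi, τ ≤ g.t s + (g.h s).toReal → ∀ c : F.SIdx,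
      |F.flatRun (F.windowRunMap ε₀ α (F.preclampY u) (F.preclampTail u)) τ c -
        F.flatRun (F.windowRunMap ε₀ α (F.preclampY v) (F.preclampTail v)) τ c| ≤
      ((sd.pYf s (e c)).toReal + (sd.ZYf s (e c)).toReal) * dd +
        ((sd.pTf s (e c)).toReal + (sd.ZTf s (e c)).toReal) * max B E ∧
      0 ≤ (sd.pTf s (e c)).toReal + (sd.ZTf s (e c)).toReal := by
  classical
  intro s hs τ hτ hτh c
  have hW1 := M.hW1
  have hn := M.hn
  have hW : 0 < F.W := lt_trans zero_lt_one hW1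
  -- `max B E ≥ 0` unless `m = 0` (then there is nothing to prove about tails, but we still need a sign)
  have hδ0 : 0 ≤ max B E := by
    have ht0' : (0 : ℝ) ∈ Icc 0 F.τhi := ⟨le_rfl, F.τhi_pos.le⟩
    exact ((abs_nonneg _).trans (hB c.1 0 ht0')).trans (le_max_left _ _)
  -- the two runs and their reference runs
  set Swu := F.windowRunMap ε₀ α (F.preclampY u) (F.preclampTail u) with hSwudef
  have hSwu : F.IsRunFrom ε₀ α (F.preclampY u) (F.preclampTail u) Swu := F.isRunFrom_windowRunMap hε hW hα hEb hEt hu.1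
  set Swv := F.windowRunMap ε₀ α (F.preclampY v) (F.preclampTail v) with hSwvdef
  have hSwv : F.IsRunFrom ε₀ α (F.preclampY v) (F.preclampTail v) Swv := F.isRunFrom_windowRunMap hε hW hα hEb hEt hv.1
  have hfu : ∀ t ∈ Icc 0 F.τhi, HasDerivWithinAt (F.flatRun Swu)
      (termField (F.wterms ε₀ α (F.preclampTail u) t) (F.flatRun Swu t)) (Icc 0 F.τhi) t := by
    intro t ht
    have h := F.hasDerivWithinAt_flatRun hSwu ht
    rwa [F.wfieldFlat_eq_termField] at h
  have hfv : ∀ t ∈ Icc 0 F.τhi, HasDerivWithinAt (F.flatRun Swv)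
      (termField (F.wterms ε₀ α (F.preclampTail v) t) (F.flatRun Swv t)) (Icc 0 F.τhi) t := by
    intro t ht
    have h := F.hasDerivWithinAt_flatRun hSwv ht
    rwa [F.wfieldFlat_eq_termField] at h
  set Scu := F.windowRunMap ε₀ α (F.preclampY (F.zeroWin u)) (F.preclampTail (F.zeroWin u)) with hScudef
  have hScu : F.IsRunFrom ε₀ α (F.preclampY (F.zeroWin u)) (F.preclampTail (F.zeroWin u)) Scu :=
    F.isRunFrom_windowRunMap hε hW hα hEb hEt (F.adm_zeroWin hu.1)
  have hfcu : ∀ t ∈ Icc 0 F.τhi, HasDerivWithinAt (F.flatRun Scu)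
      (termField (F.wterms ε₀ α (F.preclampTail u) t) (F.flatRun Scu t)) (Icc 0 F.τhi) t := by
    intro t ht
    have h := F.hasDerivWithinAt_flatRun hScu ht
    rwa [F.preclampTail_zeroWin, F.wfieldFlat_eq_termField] at h
  set Scv := F.windowRunMap ε₀ α (F.preclampY (F.zeroWin v)) (F.preclampTail (F.zeroWin v)) with hScvdef
  have hScv : F.IsRunFrom ε₀ α (F.preclampY (F.zeroWin v)) (F.preclampTail (F.zeroWin v)) Scv :=
    F.isRunFrom_windowRunMap hε hW hα hEb hEt (F.adm_zeroWin hv.1)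
  have hfcv : ∀ t ∈ Icc 0 F.τhi, HasDerivWithinAt (F.flatRun Scv)
      (termField (F.wterms ε₀ α (F.preclampTail v) t) (F.flatRun Scv t)) (Icc 0 F.τhi) t := by
    intro t ht
    have h := F.hasDerivWithinAt_flatRun hScv ht
    rwa [F.preclampTail_zeroWin, F.wfieldFlat_eq_termField] at h
  have hScu0 : F.flatRun Scu 0 = fun c : F.SIdx => F.yc c.1 ((c.2 : ℕ) : ℤ) := funext fun c => F.flatRun_zeroWin_zero hScu c
  have hScv0 : F.flatRun Scv 0 = fun c : F.SIdx => F.yc c.1 ((c.2 : ℕ) : ℤ) := funext fun c => F.flatRun_zeroWin_zero hScv c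
  have hau : F.flatRun Swu 0 ∈ boxSet (boxOf e (g.step 0).W) := M.hW0 _ fun c => F.abs_flatRun_zero_sub_yc_le hSwu c
  have hav : F.flatRun Swv 0 ∈ boxSet (boxOf e (g.step 0).W) := M.hW0 _ fun c => F.abs_flatRun_zero_sub_yc_le hSwv c
  -- the start difference
  have h0 : ∀ c : F.SIdx, |F.flatRun Swu 0 c - F.flatRun Swv 0 c| ≤ (sd.pYf 0 (e c)).toReal * dd := by
    intro c
    rw [F.flatRun_zero hSwu c, F.flatRun_zero hSwv c, F.preclampY_natCast, F.preclampY_natCast,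
      clampUnit_of_abs_le (hu.1.1 c.1 c.2), clampUnit_of_abs_le (hv.1.1 c.1 c.2)]
    have ha := F.a_pos c.1 ((c.2 : ℕ) : ℤ)
    rw [show F.yc c.1 ((c.2 : ℕ) : ℤ) + F.a c.1 ((c.2 : ℕ) : ℤ) * u.1 c.1 c.2 -
        (F.yc c.1 ((c.2 : ℕ) : ℤ) + F.a c.1 ((c.2 : ℕ) : ℤ) * v.1 c.1 c.2) =
        F.a c.1 ((c.2 : ℕ) : ℤ) * (u.1 c.1 c.2 - v.1 c.1 c.2) by ring, abs_mul, abs_of_pos ha]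
    exact hd0 c
  -- times
  have hτc := F.τc_gt
  have hrτ := F.rτ_pos
  have htS' : g.t g.S ≤ F.τhi := M.htS.trans (by unfold τhi; linarith)
  -- the sensitivity chain (part LXIX)
  have hres := g.abs_sub_le_of_gridCE_sens e hn hRDc (hRD u) (hRD v) hstep hinit hprod hpwf hpsub hplink hwlink sd hsens
    hlink hδ0 (F.twin_of_edges ε₀ α hu.1 hv.1 hB hE) htS' hP0 hScu0 hfcu hP0 hScv0 hfcv hau rfl hfu hav rfl hfv
    hdd h0 s hs τ hτ hτh c
  -- non-negativity of the tail coefficient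
  have hS := (g.step s).of_sensOK (by simpa [GridD.sensStepOK] using hsens s hs) (e c) (by rw [hn]; exact (e c).isLt)
  exact ⟨hres, add_nonneg hS.2.2.1 hS.2.2.2.1⟩

/-- With `a ≤ pY_0` the window-coordinate difference of two points is within `pY_0 · dist`. [folklore] -/
theorem start_diff_le_dist {sd : SensD} (ha0 : ∀ c : F.SIdx, F.a c.1 ((c.2 : ℕ) : ℤ) ≤ (sd.pYf 0 (e c)).toReal)
    (u v : F.Space) (c : F.SIdx) :
    F.a c.1 ((c.2 : ℕ) : ℤ) * |u.1 c.1 c.2 - v.1 c.1 c.2| ≤ (sd.pYf 0 (e c)).toReal * dist u v := by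
  have ha := F.a_pos c.1 ((c.2 : ℕ) : ℤ)
  exact mul_le_mul (ha0 c) (F.abs_fst_sub_le_dist u v c.1 c.2) (abs_nonneg _) ((ha.le).trans (ha0 c))

/-- **THE SHELL-WISE LIPSCHITZ CLAUSE `hDedge` FROM THE CENTRED GRID AND THE SENSITIVITY CHAIN.** Under the hypotheses
of `abs_run_sub_le_of_gridCE`: IF on every step `(pY_s + ZY_s) ≤ vmax`, `(pT_s + ZT_s) ≤ χ_b`, `(pT_s + ZT_s) ≤ χ_e` read
at the window coordinate (finite comparisons of emitted dyadics with the row's functions), THEN for every two `AdmLip`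
points `u, v`, every window shell `k'`, every `σ ∈ [0, τ̂ + r_τ]` and all edge bounds `B, E`:
`|x_u,j,k'(σ) − x_v,j,k'(σ)| ≤ vmax k' · dist(u,v) + χ_b k' · B + χ_e k' · E` — the clause `hDedge` of `T4W76R.ClausesFor`
& co. for the CONSTRUCTED window certificate.
[cite: Tao2016AveragedNS, §4 Lemma 4.1 (4.8), §5.3; KapelaZgliczynski2009, §4 Lemma 8 / Thm. 9; cell vocabulary, harvest/h2-tao-ladder rung1/RUNG1-P2G9-REPORT.md §37 (hDedge), rung1/RUNG1-P2G16-REPORT.md §83] -/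
theorem hDedge_of_gridCE (hε : 0 ≤ ε₀) (hα : IsCancellingCoeff α)
    (hEb : ∀ i, |F.tubeC i (-1)| + F.tubeR (-1) ≤ F.Eb) (hEt : ∀ i, |F.tubeC i F.W| + F.tubeR F.W ≤ F.Et)
    (M : F.FrameMatch g.toGridD kd e R)
    (Tc : ℕ → F.TIdx → BTerm F.SIdx) (rows : F.SIdx → List F.TIdx)
    (hRDc : ∀ s ≤ g.S, IsRTEncl (g.es e M.hn s) (Tc s) (Tc s) rows (g.step s).RD)
    (hRD : ∀ u : F.Space, ∀ s ≤ g.S, ∀ r ∈ Ico 0 (g.h s).toReal,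
      IsRTEncl (g.es e M.hn s) (Tc s) (F.wterms ε₀ α (F.preclampTail u) (g.t s + r)) rows (g.step s).RD)
    (hstep : ∀ s ≤ g.S, g.stepOK s = true) (hinit : g.initOK = true) (hprod : ∀ s < g.S, g.prodOKE s = true)
    (hpwf : ∀ s ≤ g.S, g.pwfOK s = true) (hpsub : ∀ s ≤ g.S, g.psubOK s = true)
    (hplink : ∀ s < g.S, g.plinkOK s = true) (hwlink : ∀ s < g.S, g.wlinkOK s = true)
    (hP0 : (fun c : F.SIdx => F.yc c.1 ((c.2 : ℕ) : ℤ)) ∈ boxSet (boxOf e (g.P 0)))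
    (sd : SensD) (hsens : ∀ s ≤ g.S, g.sensStepOK sd s = true) (hlink : ∀ s < g.S, g.sensLinkOK sd s = true)
    (ha0 : ∀ c : F.SIdx, F.a c.1 ((c.2 : ℕ) : ℤ) ≤ (sd.pYf 0 (e c)).toReal)
    (vmax χb χe : ℤ → ℝ)
    (hcmp : ∀ s ≤ g.S, ∀ c : F.SIdx,
      (sd.pYf s (e c)).toReal + (sd.ZYf s (e c)).toReal ≤ vmax ((c.2 : ℕ) : ℤ) ∧
      (sd.pTf s (e c)).toReal + (sd.ZTf s (e c)).toReal ≤ χb ((c.2 : ℕ) : ℤ) ∧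
      (sd.pTf s (e c)).toReal + (sd.ZTf s (e c)).toReal ≤ χe ((c.2 : ℕ) : ℤ))
    (C : F.WState × ℝ → F.WState × ℝ) (hC : ∀ r, C r = 0 → r = 0) :
    ∀ u v, F.AdmLip R u → F.AdmLip R v → ∀ j k', F.InWindow k' → ∀ σ ∈ Icc 0 F.τhi, ∀ B E : ℝ,
      (∀ i, ∀ t ∈ Icc 0 F.τhi, |F.decodeTail u i (-1) t - F.decodeTail v i (-1) t| ≤ B) →
      (∀ i, ∀ t ∈ Icc 0 F.τhi, |F.decodeTail u i F.W t - F.decodeTail v i F.W t| ≤ E) →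
      |F.fullFamily (F.windowCertOfMatrix hε (lt_trans zero_lt_one M.hW1) hα hEb hEt C hC) u j k' σ -
        F.fullFamily (F.windowCertOfMatrix hε (lt_trans zero_lt_one M.hW1) hα hEb hEt C hC) v j k' σ| ≤
      vmax k' * dist u v + χb k' * B + χe k' * E := by
  classical
  intro u v hu hv j k' hk' σ hσ B E hB hE
  have hW1 := M.hW1
  have ht0' : (0 : ℝ) ∈ Icc 0 F.τhi := ⟨le_rfl, F.τhi_pos.le⟩
  have hB0 : 0 ≤ B := (abs_nonneg _).trans (hB j 0 ht0')
  have hE0 : 0 ≤ E := (abs_nonneg _).trans (hE j 0 ht0')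
  have hδBE : max B E ≤ B + E := max_le (by linarith) (by linarith)
  -- the step containing `σ`
  have hTS' : F.τhi ≤ g.t g.S + (g.h g.S).toReal := M.hTS.le
  obtain ⟨s, hs, hσs, hσh⟩ := g.exists_step_of_le_horizon hσ.1 hσ.2 hTS'
  -- the window coordinate
  obtain ⟨hk0, hkW⟩ := hk'
  have hkn : k'.toNat < F.W := by omega
  set jj : Fin F.W := ⟨k'.toNat, hkn⟩ with hjj
  have hkj : ((jj : ℕ) : ℤ) = k' := by simp [hjj]; omega
  obtain ⟨hc, hpT⟩ := F.abs_run_sub_le_of_gridCE hε hα hEb hEt M Tc rows hRDc hRD hstep hinit hprod hpwf hpsub hplink hwlink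
    hP0 sd hsens hlink hu hv hB hE dist_nonneg (F.start_diff_le_dist ha0 u v) s hs σ ⟨hσs, hσ.2⟩ hσh (j, jj)
  have hvalu : F.flatRun (F.windowRunMap ε₀ α (F.preclampY u) (F.preclampTail u)) σ (j, jj) =
      F.fullFamily (F.windowCertOfMatrix hε (lt_trans zero_lt_one M.hW1) hα hEb hEt C hC) u j k' σ := by
    simp only [flatRun, hkj]; rfl
  have hvalv : F.flatRun (F.windowRunMap ε₀ α (F.preclampY v) (F.preclampTail v)) σ (j, jj) =
      F.fullFamily (F.windowCertOfMatrix hε (lt_trans zero_lt_one M.hW1) hα hEb hEt C hC) v j k' σ := by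
    simp only [flatRun, hkj]; rfl
  rw [hvalu, hvalv] at hc
  obtain ⟨h1, h2, h3⟩ := hcmp s hs (j, jj)
  simp only [hkj] at h1 h2 h3
  have hd := dist_nonneg (x := u) (y := v)
  calc |F.fullFamily (F.windowCertOfMatrix hε (lt_trans zero_lt_one M.hW1) hα hEb hEt C hC) u j k' σ -
        F.fullFamily (F.windowCertOfMatrix hε (lt_trans zero_lt_one M.hW1) hα hEb hEt C hC) v j k' σ|
      ≤ ((sd.pYf s (e (j, jj))).toReal + (sd.ZYf s (e (j, jj))).toReal) * dist u v +
        ((sd.pTf s (e (j, jj))).toReal + (sd.ZTf s (e (j, jj))).toReal) * max B E := hc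
    _ ≤ vmax k' * dist u v + ((sd.pTf s (e (j, jj))).toReal + (sd.ZTf s (e (j, jj))).toReal) * (B + E) := by
        gcongr
    _ = vmax k' * dist u v + ((sd.pTf s (e (j, jj))).toReal + (sd.ZTf s (e (j, jj))).toReal) * B +
        ((sd.pTf s (e (j, jj))).toReal + (sd.ZTf s (e (j, jj))).toReal) * E := by ring
    _ ≤ vmax k' * dist u v + χb k' * B + χe k' * E := by
        gcongr

end Glue

end OneShiftFrame

end DSSOneShift

end Summit.NavierStokesRegularity.NavierStokesRegularity.Theorems
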